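import Summits.Ventures.CertifiedManyBodySolver.Certificates.HubbardSquare_tpm3o10_U29o5_toyKernelCert_pauliRow
import HarnessLib

/-!
# STEP-0 of «tier P», second toy: a window certificate WITH A TRANSLATION MOVE AND A DENSITY ROW replayed in the kernel —
# the bond row `−x ≤ Re ω(c†_{0↑} c_{e₁↑} + c†_{e₁↑} c_{0↑})` for every torus-limit ground state of density `x` of the
# `t–t'` Hubbard model at `(t, t', U) = (1, −3/10, 29/5)`, ZERO hypotheses, NO claim node

HONEST FRAMING: a TOY (the bound «bond kinetic term per spin ≥ −density» is trivial physics); the point is that the two certificate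
families the first toy (`…_toyKernelCert_pauliRow`) left empty are exercised end to end here: the SYMMETRY-IDENTIFICATION family
(`symT`: one licensed translation `x ↦ x + e₁` of the inner word `−n_{0↑}`, i.e. the null word `n_{0↑} − n_{e₁↑}` of a
translation-invariant state) and the DENSITY row (`densT`, multiplier `μ_↑ = −2`). Certificate: `X + 2 n_{0↑} = (a_{0↑} + a_{e₁↑})†(a_{0↑}
+ a_{e₁↑}) + (n_{0↑} − n_{e₁↑})` — one SOS factor, one move, one density multiplier; the residual normal-orders to `0`
(`decide +kernel`), and `affineOrbitLowerRowN_of_kernelCert` + both dictionaries give the affine-N row with `q = −7/8`, slope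
`s = −1` at `n₀ = 7/8`, i.e. `−x ≤ Re ω(X)` at every density `x`. Trust base: the Lean kernel (std axioms). No number of record;
no existing claim node discharged; CONTROL/CALIBRATION context (wording (xx1)); silent on ρ_s = 0 / presence / T_c / phase; nothing
about La₂CuO₄; no summit statement is proved by this file. Seat hubbard-obs-p2 (STIFFNESS), `prover-hubbard-obs-p2-g22-0`, zero compute.

References: X. Han, arXiv:2006.06002 §3 (translation and density constraints) [Han2020Bootstrap]; J. Wang et al., PRX 14 (2024) 031006
§III [WangEtAl2024].
-/

noncomputable section

namespace Summit.Ventures.CertifiedManyBodySolver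

namespace CARPolyWindow

namespace Toy3x3

open Summit.Ventures.CertifiedQuantumChemistry Summit.Ventures.CertifiedQuantumChemistry.CARPoly
open Literature.MathematicalPhysics.QuantumLattice Literature.MathematicalPhysics.QuantumLattice.HubbardWave0
open Literature.MathematicalPhysics.QuantumManyBody.StateRelaxation
open Literature.Probability.LatticeModels ThermodynamicLimit Filter Topology
open Matrix
open scoped ComplexOrder BigOperators

/-! ## The certificate data (letters: index `0` = origin, index `1` = `e₁ = (1,0)`; spin `0 = ↑`) -/

/-- The objective: the `↑`-spin bond word `c†_{0↑} c_{e₁↑} + c†_{e₁↑} c_{0↑}`. [folklore] -/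
def TXb : Terms (Orb (Fin 9)) :=
  [([(orb 0 0, true), (orb 1 0, false)], 1), ([(orb 1 0, true), (orb 0 0, false)], 1)]

/-- The single SOS factor `a_{0↑} + a_{e₁↑}`. [folklore] -/
def Qb : List (Terms (Orb (Fin 9))) := [[([(orb 0 0, false)], 1), ([(orb 1 0, false)], 1)]]

/-- The density multipliers `μ_↑ = −2`, `μ_↓ = 0`. [folklore] -/
def mub (σ : Fin 2) : ℚ := if σ = 0 then -2 else 0

/-- The inner word moved by the translation: `−n_{0↑}` over the inner (spin) letters of `Λ = {0}`. [folklore] -/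
def SYb (_l : Fin 1) : Terms (Fin 2) := [([((0 : Fin 2), true), ((0 : Fin 2), false)], -1)]

/-- Inner inclusion on letters: spin `σ` at the origin ↦ index letter `(0, σ)`. [folklore] -/
def fb (σ : Fin 2) : Orb (Fin 9) := orb 0 σ

/-- The move on letters: spin `σ` at the origin ↦ index letter `(1, σ)` (the site `e₁`). [folklore] -/
def gb (_l : Fin 1) (σ : Fin 2) : Orb (Fin 9) := orb 1 σ

/-- The residual of the bond certificate (density row, no energy rows, one SOS factor, no eom, ONE translation move, no
charged / anti-Hermitian families). [cite: Han2020Bootstrap, §3] -/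
def bondResid : Terms (Orb (Fin 9)) :=
  residT TXb mub 0 (fun σ => orb 0 σ) 0 0 0 0 TE 0 Qb TH fb [] gb SYb [] []

/-- **The kernel evaluation**: `−7/8 ≤ lowerConst (normalize (bondResid)) + (μ_↑ + μ_↓)(n₀/2 − 0)` at `n₀ = 7/8` (the residual
normal-orders to `0`). Decided by the kernel. [cite: WangEtAl2024, §III] -/
theorem bond_lowerConst :
    (-7 / 8 : ℚ) ≤ lowerConst (CARPoly.normalize enc 32 bondResid) + (mub 0 + mub 1) * ((7 / 8 : ℚ) / 2 - 0) := by
  decide +kernel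

/-! ## The end-to-end theorem -/

/-- The inner letter map of `Λ = {0}`: spin `σ` ↦ the orbital `(0, σ)`. [folklore] -/
def dΛb (σ : Fin 2) : Orb (PolySite ({0} : Finset (Site 2))) := orb (PolySite.pt 0 (Finset.mem_singleton_self 0)) σ

/-- The translated inner window `{0} + e₁ = {e₁}` lies in `W`. [folklore] -/
theorem shift_subset_W : d4ShiftSet 1 (unitVec 0) ({0} : Finset (Site 2)) ⊆ W := by
  intro x hx
  rw [d4ShiftSet, Finset.mem_map] at hx
  obtain ⟨y, hy, rfl⟩ := hx
  rw [Finset.mem_singleton] at hy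
  subst hy
  show d4Vec 1 0 + unitVec 0 ∈ W
  rw [d4Vec_one, zero_add]
  exact unitVec_mem_thicken_one 0

/-- Membership-proof irrelevance for ordered sites. [folklore] -/
private theorem pt_congr_site'' {x y : Site 2} (hx : x ∈ W) (hy : y ∈ W) (h : x = y) :
    PolySite.pt x hx = PolySite.pt y hy := by
  subst h; rfl

/-- **STEP-0, second toy: the affine-N claim-node predicate for the bond word at `(1, −3/10, 29/5)`, value `−7/8`, slope `−1`
at `n₀ = 7/8`, from the kernel-replayed certificate with a translation move and a density row — ZERO hypotheses.**
[cite: WangEtAl2024, §III] -/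
theorem bond_affineOrbitLowerRowN :
    SquareTTPrimeCorrAffineOrbitLowerRowN (((-3 / 10 : ℚ)) : ℝ) (((29 / 5 : ℚ)) : ℝ) (-7 / 8) 0 0 0 0 (-1) (7 / 8) {1} W
      (termOp d TXb) := by
  have hz : (0 : Site 2) ∈ W := zero_mem_thicken_zero 1
  have h1 : (1 : DihedralGroup 4) ∈ ({1} : Finset (DihedralGroup 4)) := Finset.mem_singleton_self 1
  have hmul : ∀ a ∈ ({1} : Finset (DihedralGroup 4)), ∀ b ∈ ({1} : Finset (DihedralGroup 4)),
      a * b ∈ ({1} : Finset (DihedralGroup 4)) := by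
    intro a ha b hb
    rw [Finset.mem_singleton] at ha hb ⊢
    rw [ha, hb, mul_one]
  have hΛ : ({0} : Finset (Site 2)) ⊆ W := Finset.singleton_subset_iff.2 hz
  have hx0 : xs 0 = 0 := xs_zero
  have hx1 : xs 1 = d4Vec 1 0 + unitVec 0 := by rw [d4Vec_one, zero_add]; exact xs_one
  have ho : ∀ σ : Fin 2, d (orb 0 σ) = orb (PolySite.pt 0 hz) σ := by
    intro σ
    rw [d_orb, pt_congr_site'' (xs_mem 0) hz hx0]
  have hf : ∀ σ : Fin 2, d (fb σ) = Orb.embMap (PolySite.incl hΛ) (dΛb σ) := by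
    intro σ
    rw [fb, d_orb, pt_congr_site'' (xs_mem 0) (hΛ (Finset.mem_singleton_self 0)) hx0]
    rfl
  have hsh : ∀ l : Fin 1, d4ShiftSet ((fun _ : Fin 1 => (1 : DihedralGroup 4)) l) ((fun _ : Fin 1 => unitVec 0) l)
      ({0} : Finset (Site 2)) ⊆ W := fun _ => shift_subset_W
  have hg : ∀ (l : Fin 1) (σ : Fin 2), d (gb l σ) = Orb.embMap (PolySite.incl (hsh l))
      (Orb.embMap (PolySite.d4Emb ((fun _ : Fin 1 => (1 : DihedralGroup 4)) l) ((fun _ : Fin 1 => unitVec 0) l)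
        ({0} : Finset (Site 2))) (dΛb σ)) := by
    intro l σ
    rw [gb, d_orb, pt_congr_site'' (xs_mem 1)
      (shift_subset_W (d4Vec_add_mem_d4ShiftSet 1 (unitVec 0) (Finset.mem_singleton_self 0))) hx1]
    rfl
  have hH : termOp d TH = (hubbardTTPrimeFermionInteraction 1 (((-3 / 10 : ℚ)) : ℝ) (((29 / 5 : ℚ)) : ℝ)).localHamiltonian W := by
    rw [TH, termOp_hamTermsIdx 1 (-3 / 10) (29 / 5) xs xs_mem xs_injective xs_cover d d_orb, Rat.cast_one]
  have hE : termOp d TE = fermionEmbed (PolySite.incl (subset_refl W))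
      ((hubbardTTPrimeFermionInteraction 1 (((-3 / 10 : ℚ)) : ℝ) (((29 / 5 : ℚ)) : ℝ)).meanEnergyObs 1) := by
    rw [TE, termOp_energyTermsIdx 1 (-3 / 10) (29 / 5) xs xs_mem (subset_refl W) ix xs_ix_of_mem d d_orb, Rat.cast_one]
  exact affineOrbitLowerRowN_of_kernelCert (-3 / 10) (29 / 5) (by norm_num) hΛ (subset_refl W) (subset_refl W) hz h1 hmul
    d d_injective enc 32 dΛb fb hf (fun p => (ofLex p).2) (fun _ => rfl) TH hH TE hE (fun σ => orb 0 σ) ho TXb mub 0 0 0 0 0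
    0 Qb [] (fun _ : Fin 1 => (1 : DihedralGroup 4)) (fun _ => h1) (fun _ : Fin 1 => unitVec 0) hsh gb hg SYb []
    (fun wc hwc => absurd hwc (List.not_mem_nil)) [] (by norm_num [mub]) bond_lowerConst

/-- The objective IS the `↑`-spin bond word through the origin and `e₁`. [folklore] -/
theorem termOp_TXb : termOp d TXb =
    (cAt 0 (zero_mem_thicken_zero 1) 0)ᴴ * cAt (unitVec 0) (unitVec_mem_thicken_one 0) 0 +
      (cAt (unitVec 0) (unitVec_mem_thicken_one 0) 0)ᴴ * cAt 0 (zero_mem_thicken_zero 1) 0 := by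
  have hz : (0 : Site 2) ∈ W := zero_mem_thicken_zero 1
  have he : unitVec 0 ∈ W := unitVec_mem_thicken_one 0
  have h0 : d (orb 0 0) = orb (PolySite.pt 0 hz) 0 := by rw [d_orb, pt_congr_site'' (xs_mem 0) hz xs_zero]
  have h1 : d (orb 1 0) = orb (PolySite.pt (unitVec 0) he) 0 := by rw [d_orb, pt_congr_site'' (xs_mem 1) he xs_one]
  have hw1 : wmap d [(orb 0 0, true), (orb 1 0, false)] = [(d (orb 0 0), true), (d (orb 1 0), false)] := rfl
  have hw2 : wmap d [(orb 1 0, true), (orb 0 0, false)] = [(d (orb 1 0), true), (d (orb 0 0), false)] := rfl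
  rw [TXb, termOp_cons, termOp_cons, termOp_nil, add_zero, Rat.cast_one, one_smul, one_smul, hw1, hw2, h0, h1,
    ladderWord_cons, ladderWord_cons, ladderWord_nil, mul_one, ladderWord_cons, ladderWord_cons, ladderWord_nil, mul_one,
    cAt, cAt, annihilation_conjTranspose, annihilation_conjTranspose]
  congr 1

/-- **THE BOND ROW, KERNEL-REPLAYED**: for every density `x ∈ [0, 2)` and every torus limit `ω` of unit sector ground states of
`hubbardTorusTT' L 1 (−3/10) (29/5)` along `L → ∞`: `−x ≤ Re ω(c†_{0↑} c_{e₁↑} + c†_{e₁↑} c_{0↑})` — from the SOS factor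
`a_{0↑} + a_{e₁↑}`, the translation null word `n_{0↑} − n_{e₁↑}` and the density row, through the whole kernel-form pipeline.
[cite: Han2020Bootstrap, §3] -/
theorem toy_bond_row (x : ℝ) (hx0 : 0 ≤ x) (hx2 : x < 2) (ω : InfVolFermionState 2) (Ls : ℕ → ℕ)
    (ψ : ∀ L, Fock (Orb (FermionTorus 2 L))) (hLs : Tendsto Ls atTop atTop)
    (hψ : ∀ j, IsGroundStateInSector (hubbardTorusTT' (Ls j) 1 (((-3 / 10 : ℚ)) : ℝ) (((29 / 5 : ℚ)) : ℝ)) (rectN x (Ls j)) 0 (ψ (Ls j)))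
    (hψ1 : ∀ j, star (ψ (Ls j)) ⬝ᵥ ψ (Ls j) = 1) (hω : ω.IsTorusLimitOf ψ Ls) :
    -x ≤ (ω.expect W ((cAt 0 (zero_mem_thicken_zero 1) 0)ᴴ * cAt (unitVec 0) (unitVec_mem_thicken_one 0) 0 +
      (cAt (unitVec 0) (unitVec_mem_thicken_one 0) 0)ᴴ * cAt 0 (zero_mem_thicken_zero 1) 0)).re := by
  have h := bond_affineOrbitLowerRowN x hx0 hx2 ω Ls ψ hLs hψ hψ1 hω
  rw [termOp_TXb, Finset.sum_singleton, Finset.card_singleton, Nat.cast_one, inv_one, one_mul,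
    ω.expect_fermionEmbed_d4Emb_one_zero] at h
  push_cast at h
  linarith

end Toy3x3

end CARPolyWindow

end Summit.Ventures.CertifiedManyBodySolver

end
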